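import Mathlib
import Summits.ValiantsHypothesis.ValiantsHypothesis.Theorems.DivisionGapPerMultiplesHardOrderedFactorPerturb
import Summits.ValiantsHypothesis.ValiantsHypothesis.Theorems.DivisionGapPerMultiplesHardStubRegularPairFactor
import Summits.ValiantsHypothesis.ValiantsHypothesis.Theorems.DivisionGapPerMultiplesHardStubCodegreeMixing
import Summits.ValiantsHypothesis.ValiantsHypothesis.Theorems.DivisionGapPerMultiplesHardStubSwapRepair
import Summits.ValiantsHypothesis.ValiantsHypothesis.Theorems.DivisionGapPerMultiplesHardStubColumnRunsArith

/-!
# `DivisionGap.PerMultiplesHard` (stmt-ValiantsHypothesis-5068), line `uncharged-face-walk`: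
the ORDERED FACTOR, part 4 of 5 — a quasi-random block has a cyclic order whose shifted intersection carries a linear
regular factor; hence rich host + complete class + quasi-random σ-square block ⇒ hard (lead c8, cycle 8)

`orderedFactor` is the registered stub `stub_orderedFactor` of the skeleton `Cruxes/PerMultiplesHard/Lines/uncharged_face_walk.lean`,
verbatim: for all `D₁, D₂ ≥ 1` there are `D₃, E, Cf, a₀` (the proof gives `Q = 64D₁⁴D₂`, `R = 256Q⁴D₂²`, `D₃ = 512R`,
`E = 2048R`, `Cf = 16Q`, `a₀ = max(a₀(D₁), 1024R)`) such that every block with minimum column degree `a/D₁`, typical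
codegree `c₂ ∈ [a/D₂, a]`, `D₃`-small 2- and 4-wise deviations and `≤ a/E` low-codegree partners per row has an order `ρ`
and an `f`-regular `Y' ⊆ shiftH X ρ`, `f = a/(8Q) ≥ 1`, `a ≤ 16Q·f`.
Proof.  (1) `exists_good_order` (part 2).  (2) `stub_swapRepair` with `t = a/D₂`, `e = a/E`: an order `ρ'` with NO bad
position and `#C ≤ 4·#bad ≤ 64a/E + 32` changed positions.  (3) The statistics of `H = shiftH X ρ'` (part 3) feed
`stub_codegreeMixing` with `q = c₂/a`, `η₁ = (dev₁ + a#C)/a²`, `η₂ = (dev₂ + a²|c₄ − c₂²/a| + 2a²#C + 2a²)/a³`: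
lower mixing with `ε = √(3η₁ + η₂ + 1/a) ≤ 1/(16Q²D₂)` (`arith_eta`), so `√(ε/q) ≤ 1/(4Q)` (`sqrt_bound`).  (4) Minimum
row degree `t`, minimum column degree `a/(64D₁⁴) − #C`, both `≥ a/(2Q)` (`nat_L`); `exists_regularFactor_of_mixing`
(`stub_regularPairFactor` + Ore) gives the factor with `f = a/(8Q)`.  Part 5 (`OrderedFactorRichHost`) feeds it into
the tree's `richHost_of_squareBlock` (p134108).  The heartbeat budget of `orderedFactor` is raised (long bookkeeping in
one context). Elementary given the stubs. [folklore]
-/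

noncomputable section

-- `Summit.ValiantsHypothesis.ValiantsHypothesis.…` is the tree's mandated layout (Sub = Summit).
set_option linter.dupNamespace false

open Finset
open scoped BigOperators

namespace Summit.ValiantsHypothesis.ValiantsHypothesis.Theorems.DivisionGap.PerMultiplesHard.OrderedFactor

set_option maxHeartbeats 800000 in
/-- **The ordered factor (lead c8).**  For all `D₁, D₂ ≥ 1` there are `D₃, E, Cf, a₀` such that every block
`X ⊆ Fin a × Fin a` (`a ≥ a₀`) with minimum column degree `a/D₁`, a typical codegree `c₂` with `a/D₂ ≤ c₂ ≤ a`,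
`ℓ¹`-small 2- and 4-wise deviations (`D₃·Dev₂ ≤ a³`, `D₃·Dev₄ ≤ a⁵`, `D₃·|c₄ a − c₂²| ≤ a²`) and at most `a/E`
low-codegree partners per row has an order `ρ` and an `f`-regular `Y'` (`f ≥ 1`, `a ≤ Cf f`) inside the shifted
intersection `{(k, y) : (ρ k, y) ∈ X ∧ (ρ(k−1), y) ∈ X}`.  This is the registered stub `stub_orderedFactor` of the
skeleton `Cruxes/PerMultiplesHard/Lines/uncharged_face_walk.lean`, verbatim (the heartbeat budget is raised for the long
bookkeeping proof). [folklore] -/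
theorem stub_orderedFactor :
    ∀ D₁ D₂ : ℕ, 1 ≤ D₁ → 1 ≤ D₂ → ∃ D₃ E Cf a₀ : ℕ, 1 ≤ D₃ ∧ 1 ≤ E ∧ 1 ≤ Cf ∧
      ∀ a ≥ a₀, ∀ (X : Finset (Fin a × Fin a)) (c₂ c₄ : ℕ),
        (∀ x : Fin a, a ≤ D₁ * (Finset.univ.filter fun y : Fin a => (x, y) ∈ X).card) →
        (∀ y : Fin a, a ≤ D₁ * (Finset.univ.filter fun x : Fin a => (x, y) ∈ X).card) →
        a ≤ D₂ * c₂ → c₂ ≤ a →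
        (D₃ : ℝ) * (∑ x : Fin a, ∑ x' ∈ Finset.univ.erase x,
            |(((Finset.univ.filter fun y : Fin a => (x, y) ∈ X ∧ (x', y) ∈ X).card : ℕ) : ℝ) - c₂|) ≤ (a : ℝ) ^ 3 →
        (D₃ : ℝ) * (∑ x₁ : Fin a, ∑ x₂ ∈ Finset.univ.erase x₁, ∑ x₃ ∈ (Finset.univ.erase x₁).erase x₂,
            ∑ x₄ ∈ ((Finset.univ.erase x₁).erase x₂).erase x₃,
            |(((Finset.univ.filter fun y : Fin a =>
                (x₁, y) ∈ X ∧ (x₂, y) ∈ X ∧ (x₃, y) ∈ X ∧ (x₄, y) ∈ X).card : ℕ) : ℝ) - c₄|) ≤ (a : ℝ) ^ 5 →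
        (D₃ : ℝ) * |(c₄ : ℝ) * a - (c₂ : ℝ) ^ 2| ≤ (a : ℝ) ^ 2 →
        (∀ x : Fin a, E * (Finset.univ.filter fun y : Fin a => y ≠ x ∧
            (Finset.univ.filter fun z : Fin a => (x, z) ∈ X ∧ (y, z) ∈ X).card < a / D₂).card ≤ a) →
        ∃ (ρ : Equiv.Perm (Fin a)) (Y' : Finset (Fin a × Fin a)) (f : ℕ), 1 ≤ f ∧ a ≤ Cf * f ∧
          Y' ⊆ Finset.univ.filter (fun e : Fin a × Fin a =>
            (ρ e.1, e.2) ∈ X ∧ (ρ ((finRotate a).symm e.1), e.2) ∈ X) ∧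
          (∀ x : Fin a, (Finset.univ.filter fun y : Fin a => (x, y) ∈ Y').card = f) ∧
          (∀ y : Fin a, (Finset.univ.filter fun x : Fin a => (x, y) ∈ Y').card = f) := by
  classical
  intro D₁ D₂ hD₁ hD₂
  obtain ⟨a₁, harith⟩ := ColumnRunsArith.stub_columnRunsArith D₁ hD₁
  -- constants (kept opaque)
  obtain ⟨Q, hQ⟩ : ∃ Q : ℕ, Q = 64 * D₁ ^ 4 * D₂ := ⟨_, rfl⟩
  obtain ⟨R, hR⟩ : ∃ R : ℕ, R = 256 * Q ^ 4 * D₂ ^ 2 := ⟨_, rfl⟩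
  have hD14 : 1 ≤ D₁ ^ 4 := Nat.one_le_pow _ _ hD₁
  have hQ64 : 64 ≤ Q := by
    rw [hQ]; calc 64 = 64 * 1 * 1 := by norm_num
      _ ≤ 64 * D₁ ^ 4 * D₂ := by gcongr
  have hQD₂ : D₂ ≤ Q := by
    rw [hQ]; calc D₂ = 1 * D₂ := by ring
      _ ≤ (64 * D₁ ^ 4) * D₂ := by gcongr; omega
  have hQD₁ : 64 * D₁ ^ 4 ≤ Q := by
    rw [hQ]; calc 64 * D₁ ^ 4 = 64 * D₁ ^ 4 * 1 := by ring
      _ ≤ 64 * D₁ ^ 4 * D₂ := by gcongr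
  have hRQ : Q ≤ R := by
    rw [hR]
    have : Q ^ 4 = Q * Q ^ 3 := by ring
    calc Q = 1 * (Q * 1) * 1 := by ring
      _ ≤ 256 * (Q * Q ^ 3) * D₂ ^ 2 := by
          gcongr
          · norm_num
          · exact Nat.one_le_pow _ _ (by omega)
          · exact Nat.one_le_pow _ _ hD₂
      _ = 256 * Q ^ 4 * D₂ ^ 2 := by rw [this]
  refine ⟨512 * R, 2048 * R, 16 * Q, max a₁ (1024 * R), by omega, by omega, by omega, ?_⟩
  intro a ha X c₂ c₄ _hrow hcol hc₂ hc₂a hdev₂ hdev₄ hc₄ hbad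
  obtain ⟨E, hE⟩ : ∃ E : ℕ, E = 2048 * R := ⟨_, rfl⟩
  obtain ⟨D₃, hD₃⟩ : ∃ D₃ : ℕ, D₃ = 512 * R := ⟨_, rfl⟩
  rw [← hE] at hbad
  rw [← hD₃] at hdev₂ hdev₄ hc₄
  -- sizes
  have ha₁ : a₁ ≤ a := le_trans (le_max_left _ _) ha
  have haR : 1024 * R ≤ a := le_trans (le_max_right _ _) ha
  have haQ : 1024 * Q ≤ a := le_trans (by gcongr) haR
  have ha16 : 16 ≤ a := by omega
  have hapos : 0 < a := by omega
  have haposR : (0 : ℝ) < a := by exact_mod_cast hapos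
  have ha2R : (2 : ℝ) ≤ a := by exact_mod_cast (show 2 ≤ a by omega)
  have ha16R : (16 : ℝ) ≤ a := by exact_mod_cast ha16
  have hRpos : (0 : ℝ) < R := by exact_mod_cast (show 0 < R by omega)
  have hEpos : 0 < E := by omega
  have hE16 : 16 ≤ E := by omega
  have hEposR : (0 : ℝ) < E := by exact_mod_cast hEpos
  have hD₃R : (D₃ : ℝ) = 512 * R := by rw [hD₃]; push_cast; ring
  have hER : (E : ℝ) = 2048 * R := by rw [hE]; push_cast; ring
  have hD₃pos : (0 : ℝ) < D₃ := by rw [hD₃R]; positivity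
  -- thresholds (opaque)
  obtain ⟨t, ht⟩ : ∃ t : ℕ, t = a / D₂ := ⟨_, rfl⟩
  obtain ⟨e, he⟩ : ∃ e : ℕ, e = a / E := ⟨_, rfl⟩
  rw [← ht] at hbad
  -- step 1: first moment
  obtain ⟨ρ, hb, hd1, hd2, hwcol⟩ :=
    exists_good_order X D₁ a₁ harith ha₁ (by omega) t (c₂ : ℝ) (c₄ : ℝ) hcol
  obtain ⟨dv1, hdv1⟩ : ∃ r : ℝ, r = (∑ k : Fin a, |((((Finset.univ.filter fun yy : Fin a => (ρ k, yy) ∈ X ∧ (ρ ((finRotate a).symm k), yy) ∈ X).card) : ℕ) : ℝ) - c₂|) := ⟨_, rfl⟩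
  obtain ⟨dv2, hdv2⟩ : ∃ r : ℝ, r = (∑ k : Fin a, ∑ k' ∈ (((Finset.univ.erase k).erase ((finRotate a).symm k)).erase (finRotate a k)), |((((Finset.univ.filter fun yy : Fin a => (ρ k, yy) ∈ X ∧ (ρ ((finRotate a).symm k), yy) ∈ X ∧ (ρ k', yy) ∈ X ∧ (ρ ((finRotate a).symm k'), yy) ∈ X).card) : ℕ) : ℝ) - c₄|) := ⟨_, rfl⟩
  rw [← hdv1] at hd1
  rw [← hdv2] at hd2
  -- step 2: repair
  have hpart : ∀ x : Fin a, (Finset.univ.filter fun y : Fin a => y ≠ x ∧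
      (Finset.univ.filter fun z : Fin a => (x, z) ∈ X ∧ (y, z) ∈ X).card < t).card ≤ e := by
    intro x
    rw [he, Nat.le_div_iff_mul_le hEpos, mul_comm]
    exact hbad x
  have h4e : 4 * e + 8 ≤ a := by
    have : e ≤ a / 16 := by rw [he]; exact Nat.div_le_div_left hE16 (by norm_num)
    omega
  obtain ⟨ρ', hgood, hC⟩ := SwapRepair.stub_swapRepair a t e X h4e hpart ρ
  -- the changed set, in local vocabulary
  obtain ⟨C, hCdef⟩ : ∃ C : Finset (Fin a),
      C = Finset.univ.filter fun k : Fin a => (ρ' k, ρ' (((finRotate a).symm k))) ≠ (ρ k, ρ (((finRotate a).symm k))) := ⟨_, rfl⟩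
  have hC' : C.card ≤ 4 * ((Finset.univ.filter fun kk : Fin a => (Finset.univ.filter fun yy : Fin a => (ρ kk, yy) ∈ X ∧ (ρ ((finRotate a).symm kk), yy) ∈ X).card < t)).card := by rw [hCdef]; exact hC
  have hgood' : ∀ k : Fin a, t ≤ ((Finset.univ.filter fun yy : Fin a => ((ρ' k), yy) ∈ X ∧ ((ρ' (((finRotate a).symm k))), yy) ∈ X).card) := hgood
  clear hC hgood
  -- real bookkeeping of the first-moment bounds
  have hBp : (∑ x : Fin a, ∑ x' ∈ Finset.univ.erase x, (if (Finset.univ.filter fun yy : Fin a => (x, yy) ∈ X ∧ (x', yy) ∈ X).card < t then (1 : ℝ) else 0)) ≤ (a : ℝ) * ((a : ℝ) / E) := by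
    rw [Bpairs_eq]
    calc ∑ x : Fin a, ((Finset.univ.filter fun y : Fin a => y ≠ x ∧ ((Finset.univ.filter fun yy : Fin a => (x, yy) ∈ X ∧ (y, yy) ∈ X).card) < t).card : ℝ)
        ≤ ∑ _x : Fin a, (a : ℝ) / E := Finset.sum_le_sum fun x _ => by
          have h1 : ((Finset.univ.filter fun y : Fin a => y ≠ x ∧ ((Finset.univ.filter fun yy : Fin a => (x, yy) ∈ X ∧ (y, yy) ∈ X).card) < t).card : ℝ) ≤ (e : ℝ) := by
            exact_mod_cast hpart x
          exact h1.trans (by rw [he]; exact Nat.cast_div_le)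
      _ = (a : ℝ) * ((a : ℝ) / E) := by simp
  have ham1 : (0 : ℝ) < (a : ℝ) - 1 := by linarith
  have hnC : (C.card : ℝ) ≤ 64 * ((a : ℝ) / E) + 32 := by
    have h1 : (C.card : ℝ) ≤ 4 * (((Finset.univ.filter fun kk : Fin a => (Finset.univ.filter fun yy : Fin a => (ρ kk, yy) ∈ X ∧ (ρ ((finRotate a).symm kk), yy) ∈ X).card < t)).card : ℝ) := by exact_mod_cast hC'
    have h2 : (∑ x : Fin a, ∑ x' ∈ Finset.univ.erase x, (if (Finset.univ.filter fun yy : Fin a => (x, yy) ∈ X ∧ (x', yy) ∈ X).card < t then (1 : ℝ) else 0)) / ((a : ℝ) - 1) ≤ (a : ℝ) * ((a : ℝ) / E) / ((a : ℝ) - 1) :=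
      div_le_div_of_nonneg_right hBp ham1.le
    have h3 := aux3 ha2R hEposR
    linarith
  have hDev₂ : (∑ x : Fin a, ∑ x' ∈ Finset.univ.erase x, |(((Finset.univ.filter fun yy : Fin a => (x, yy) ∈ X ∧ (x', yy) ∈ X).card : ℕ) : ℝ) - c₂|) ≤ (a : ℝ) ^ 3 / D₃ := by
    rw [le_div_iff₀ hD₃pos, mul_comm]; exact hdev₂
  have hDev₄ : (∑ x₁ : Fin a, ∑ x₂ ∈ Finset.univ.erase x₁, ∑ x₃ ∈ (Finset.univ.erase x₁).erase x₂, ∑ x₄ ∈ ((Finset.univ.erase x₁).erase x₂).erase x₃, |(((Finset.univ.filter fun yy : Fin a => (x₁, yy) ∈ X ∧ (x₂, yy) ∈ X ∧ (x₃, yy) ∈ X ∧ (x₄, yy) ∈ X).card : ℕ) : ℝ) - c₄|) ≤ (a : ℝ) ^ 5 / D₃ := by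
    rw [le_div_iff₀ hD₃pos, mul_comm]; exact hdev₄
  clear hdev₂ hdev₄
  have hdev1 : dv1 ≤ 16 * ((a : ℝ) ^ 2 / D₃) + 8 := by
    have h1 : (∑ x : Fin a, ∑ x' ∈ Finset.univ.erase x, |(((Finset.univ.filter fun yy : Fin a => (x, yy) ∈ X ∧ (x', yy) ∈ X).card : ℕ) : ℝ) - c₂|) / ((a : ℝ) - 1) ≤ (a : ℝ) ^ 3 / D₃ / ((a : ℝ) - 1) :=
      div_le_div_of_nonneg_right hDev₂ ham1.le
    have h2 := aux1 ha2R hD₃pos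
    linarith
  have hdev2 : dv2 ≤ 16 * ((a : ℝ) ^ 3 / D₃) + 8 := by
    have e1 : 0 < (a : ℝ) - 1 := by linarith
    have e2 : 0 < (a : ℝ) - 2 := by linarith
    have e3 : 0 < (a : ℝ) - 3 := by linarith
    have hden : (0 : ℝ) < ((a : ℝ) - 1) * ((a : ℝ) - 2) * ((a : ℝ) - 3) := mul_pos (mul_pos e1 e2) e3
    have h1 : (a : ℝ) * (∑ x₁ : Fin a, ∑ x₂ ∈ Finset.univ.erase x₁, ∑ x₃ ∈ (Finset.univ.erase x₁).erase x₂, ∑ x₄ ∈ ((Finset.univ.erase x₁).erase x₂).erase x₃, |(((Finset.univ.filter fun yy : Fin a => (x₁, yy) ∈ X ∧ (x₂, yy) ∈ X ∧ (x₃, yy) ∈ X ∧ (x₄, yy) ∈ X).card : ℕ) : ℝ) - c₄|) / (((a : ℝ) - 1) * ((a : ℝ) - 2) * ((a : ℝ) - 3)) ≤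
        (a : ℝ) * ((a : ℝ) ^ 5 / D₃) / (((a : ℝ) - 1) * ((a : ℝ) - 2) * ((a : ℝ) - 3)) :=
      div_le_div_of_nonneg_right (mul_le_mul_of_nonneg_left hDev₄ haposR.le) hden.le
    have h2 := aux2 ha16R hD₃pos
    linarith
  clear hd1 hd2 hb hDev₂ hDev₄ hBp
  -- the consistency of c₄ with c₂
  have hcc : |(c₄ : ℝ) - (c₂ : ℝ) ^ 2 / a| ≤ (a : ℝ) / D₃ := by
    have h1 : (c₄ : ℝ) - (c₂ : ℝ) ^ 2 / a = ((c₄ : ℝ) * a - (c₂ : ℝ) ^ 2) / a := by field_simp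
    rw [h1, abs_div, abs_of_pos haposR, div_le_div_iff₀ haposR hD₃pos]
    nlinarith [hc₄, abs_nonneg ((c₄ : ℝ) * a - (c₂ : ℝ) ^ 2)]
  clear hc₄
  -- the host H and its statistics
  obtain ⟨q, hq⟩ : ∃ q : ℝ, q = (c₂ : ℝ) / a := ⟨_, rfl⟩
  have hc₂R : (c₂ : ℝ) ≤ a := by exact_mod_cast hc₂a
  have hc₂pos : (1 : ℝ) ≤ c₂ := by
    have : 1 ≤ c₂ := by
      rcases Nat.eq_zero_or_pos c₂ with h0 | h0
      · rw [h0, mul_zero] at hc₂; omega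
      · exact h0
    exact_mod_cast this
  have hq0 : 0 < q := by rw [hq]; positivity
  have hq1 : q ≤ 1 := by rw [hq, div_le_one haposR]; exact hc₂R
  have hqa : q * a = c₂ := by rw [hq]; field_simp
  have hq2a : q ^ 2 * a = (c₂ : ℝ) ^ 2 / a := by rw [hq]; field_simp
  have hcsq0 : 0 ≤ (c₂ : ℝ) ^ 2 / a := by positivity
  have hcsqa : (c₂ : ℝ) ^ 2 / a ≤ a := by
    rw [div_le_iff₀ haposR]; nlinarith
  obtain ⟨η₁, hη₁⟩ : ∃ η₁ : ℝ, η₁ = (dv1 + (a : ℝ) * C.card) / (a : ℝ) ^ 2 := ⟨_, rfl⟩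
  obtain ⟨η₂, hη₂⟩ : ∃ η₂ : ℝ, η₂ = (dv2 + (a : ℝ) * a * |(c₄ : ℝ) - (c₂ : ℝ) ^ 2 / a| +
      2 * ((a : ℝ) * a) * C.card + 2 * (a : ℝ) * a) / (a : ℝ) ^ 3 := ⟨_, rfl⟩
  have hdev₁0 : 0 ≤ dv1 := by rw [hdv1]; exact Finset.sum_nonneg fun _ _ => abs_nonneg _
  have hdev₂0 : 0 ≤ dv2 := by
    rw [hdv2]; exact Finset.sum_nonneg fun _ _ => Finset.sum_nonneg fun _ _ => abs_nonneg _
  have hη₁0 : 0 ≤ η₁ := by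
    rw [hη₁]; refine div_nonneg ?_ (by positivity)
    have h2 : 0 ≤ (a : ℝ) * C.card := by positivity
    linarith
  have hη₂0 : 0 ≤ η₂ := by
    rw [hη₂]; refine div_nonneg ?_ (by positivity)
    have h1 : 0 ≤ (a : ℝ) * a * |(c₄ : ℝ) - (c₂ : ℝ) ^ 2 / a| := by positivity
    have h2 : 0 ≤ 2 * ((a : ℝ) * a) * C.card := by positivity
    have h3 : 0 ≤ 2 * (a : ℝ) * a := by positivity
    linarith
  have hη₁e : η₁ * (a : ℝ) ^ 2 = dv1 + (a : ℝ) * C.card := by rw [hη₁]; field_simp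
  have hη₂e : η₂ * (a : ℝ) ^ 3 = dv2 + (a : ℝ) * a * |(c₄ : ℝ) - (c₂ : ℝ) ^ 2 / a| +
      2 * ((a : ℝ) * a) * C.card + 2 * (a : ℝ) * a := by rw [hη₂]; field_simp
  have S1 : ∑ x : Fin a, |(((Finset.univ.filter fun y : Fin a => (x, y) ∈ (Finset.univ.filter fun ee : Fin a × Fin a => (ρ' ee.1, ee.2) ∈ X ∧ (ρ' ((finRotate a).symm ee.1), ee.2) ∈ X)).card : ℕ) : ℝ) - q * a| ≤
      η₁ * (a : ℝ) ^ 2 := by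
    simp only [rowdeg_shiftH, hqa, hη₁e]
    have := dev₁_perturb X c₂ (by positivity) hc₂R ρ ρ'
    rw [← hCdef, ← hdv1] at this
    exact this
  have S2 : ∑ x : Fin a, ∑ x' ∈ Finset.univ.erase x,
      |(((Finset.univ.filter fun y : Fin a => (x, y) ∈ (Finset.univ.filter fun ee : Fin a × Fin a => (ρ' ee.1, ee.2) ∈ X ∧ (ρ' ((finRotate a).symm ee.1), ee.2) ∈ X) ∧ (x', y) ∈ (Finset.univ.filter fun ee : Fin a × Fin a => (ρ' ee.1, ee.2) ∈ X ∧ (ρ' ((finRotate a).symm ee.1), ee.2) ∈ X)).card : ℕ) : ℝ) -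
        q ^ 2 * a| ≤ η₂ * (a : ℝ) ^ 3 := by
    simp only [codeg_shiftH, hq2a, hη₂e]
    have hpt : ∀ x : Fin a, ∑ x' ∈ Finset.univ.erase x,
        |(((Finset.univ.filter fun yy : Fin a => ((ρ' x), yy) ∈ X ∧ ((ρ' (((finRotate a).symm x))), yy) ∈ X ∧ ((ρ' x'), yy) ∈ X ∧ ((ρ' (((finRotate a).symm x'))), yy) ∈ X).card) : ℝ) - (c₂ : ℝ) ^ 2 / a| ≤
        (∑ x' ∈ (((Finset.univ.erase x).erase ((finRotate a).symm x)).erase (finRotate a x)), |(((Finset.univ.filter fun yy : Fin a => ((ρ' x), yy) ∈ X ∧ ((ρ' (((finRotate a).symm x))), yy) ∈ X ∧ ((ρ' x'), yy) ∈ X ∧ ((ρ' (((finRotate a).symm x'))), yy) ∈ X).card) : ℝ) - (c₂ : ℝ) ^ 2 / a|) + 2 * a :=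
      fun x => sum_erase_le_nonAdj (fun _ => abs_nonneg _)
        (fun x' => abs_sub_le_of_mem (by positivity) (by exact_mod_cast quad_le X _ _ _ _) hcsq0 hcsqa) x
    have hmain := dev₂_perturb X (c₄ : ℝ) ((c₂ : ℝ) ^ 2 / a) hcsq0 hcsqa ρ ρ'
    rw [← hCdef, ← hdv2] at hmain
    calc ∑ x : Fin a, ∑ x' ∈ Finset.univ.erase x,
          |(((Finset.univ.filter fun yy : Fin a => ((ρ' x), yy) ∈ X ∧ ((ρ' (((finRotate a).symm x))), yy) ∈ X ∧ ((ρ' x'), yy) ∈ X ∧ ((ρ' (((finRotate a).symm x'))), yy) ∈ X).card) : ℝ) - (c₂ : ℝ) ^ 2 / a|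
        ≤ ∑ x : Fin a, ((∑ x' ∈ (((Finset.univ.erase x).erase ((finRotate a).symm x)).erase (finRotate a x)),
            |(((Finset.univ.filter fun yy : Fin a => ((ρ' x), yy) ∈ X ∧ ((ρ' (((finRotate a).symm x))), yy) ∈ X ∧ ((ρ' x'), yy) ∈ X ∧ ((ρ' (((finRotate a).symm x'))), yy) ∈ X).card) : ℝ) - (c₂ : ℝ) ^ 2 / a|) + 2 * a) :=
          Finset.sum_le_sum fun x _ => hpt x
      _ = (∑ x : Fin a, ∑ x' ∈ (((Finset.univ.erase x).erase ((finRotate a).symm x)).erase (finRotate a x)),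
            |(((Finset.univ.filter fun yy : Fin a => ((ρ' x), yy) ∈ X ∧ ((ρ' (((finRotate a).symm x))), yy) ∈ X ∧ ((ρ' x'), yy) ∈ X ∧ ((ρ' (((finRotate a).symm x'))), yy) ∈ X).card) : ℝ) - (c₂ : ℝ) ^ 2 / a|) + 2 * (a : ℝ) * a := by
          rw [Finset.sum_add_distrib, Finset.sum_const, Finset.card_univ, Fintype.card_fin, nsmul_eq_mul]; ring
      _ ≤ _ := by linarith
  have hmix := CodegreeMixing.stub_codegreeMixing a ((Finset.univ.filter fun ee : Fin a × Fin a => (ρ' ee.1, ee.2) ∈ X ∧ (ρ' ((finRotate a).symm ee.1), ee.2) ∈ X)) q η₁ η₂ (by omega) hq0.le hq1 hη₁0 hη₂0 S1 S2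
  clear S1 S2
  -- the precision bound and the square roots
  have haR' : (1024 : ℝ) * R ≤ a := by exact_mod_cast haR
  have hR1 : (1 : ℝ) ≤ R := by exact_mod_cast (show 1 ≤ R by omega)
  have hη : 3 * η₁ + η₂ + 1 / a ≤ 1 / R :=
    arith_eta hR1 hD₃R hER haR' hη₁e hη₂e hdev1 hdev2 hcc hnC
  have hε0 : 0 ≤ Real.sqrt (3 * η₁ + η₂ + 1 / a) := Real.sqrt_nonneg _
  have hQposR : (0 : ℝ) < Q := by exact_mod_cast (show 0 < Q by omega)
  have hD₂R : (0 : ℝ) < D₂ := by exact_mod_cast (show 0 < D₂ by omega)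
  have hRsq : (R : ℝ) = (16 * (Q : ℝ) ^ 2 * D₂) ^ 2 := by rw [hR]; push_cast; ring
  have hqD : 1 ≤ q * D₂ := by
    rw [hq, div_mul_eq_mul_div, le_div_iff₀ haposR, one_mul]
    have : (a : ℝ) ≤ D₂ * c₂ := by exact_mod_cast hc₂
    linarith
  have hsq : Real.sqrt (Real.sqrt (3 * η₁ + η₂ + 1 / a) / q) ≤ 1 / (4 * Q) :=
    sqrt_bound hQposR hD₂R hq0 hqD hRsq rfl hη
  -- minimum degrees
  obtain ⟨w, hw⟩ : ∃ w : ℕ, w = a / (64 * D₁ ^ 4) := ⟨_, rfl⟩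
  have hQpos' : 0 < Q := by omega
  have hCn : C.card ≤ a / (32 * Q) + 32 := by
    refine nat_le_div_add (by omega) (hnC.trans ?_)
    push_cast
    have h1 : 64 * ((a : ℝ) / E) ≤ (a : ℝ) / (32 * Q) := by
      rw [hER]; exact aux5 haposR.le (by exact_mod_cast hRQ) hQposR hRpos
    linarith
  have hLp : a / (2 * Q) ≤ min t (w - C.card) := by
    refine nat_L hQpos' (by omega) hCn ?_ ?_
    · rw [hw]; exact Nat.div_le_div_left hQD₁ (by omega)
    · rw [ht]; exact Nat.div_le_div_left (by omega) (by omega)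
  obtain ⟨L, hL⟩ : ∃ L : ℕ, L = min t (w - C.card) := ⟨_, rfl⟩
  rw [← hL] at hLp
  -- f
  obtain ⟨f, hf⟩ : ∃ f : ℕ, f = a / (8 * Q) := ⟨_, rfl⟩
  have hf1 : 1 ≤ f := by
    rw [hf, Nat.le_div_iff_mul_le (by omega)]; omega
  have hfC : a ≤ 16 * Q * f := by
    have h1 : a < a / (8 * Q) * (8 * Q) + 8 * Q := Nat.lt_div_mul_add (by omega)
    rw [hf]; nlinarith
  -- the factor
  obtain ⟨ηη, hηη⟩ : ∃ ηη : ℝ, ηη = q - (L : ℝ) / a := ⟨_, rfl⟩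
  have hLc : (L : ℝ) ≤ c₂ := by
    have h1 : L ≤ t := by rw [hL]; exact min_le_left _ _
    have h2 : t ≤ c₂ := by rw [ht]; exact Nat.div_le_of_le_mul hc₂
    exact_mod_cast h1.trans h2
  have hηη0 : 0 ≤ ηη := by
    rw [hηη, hq, sub_nonneg, div_le_div_iff_of_pos_right haposR]; exact hLc
  have hβη : (q - ηη) * a = L := by rw [hηη]; field_simp; ring
  have hrowH : ∀ i : Fin a, (q - ηη) * a ≤
      (((Finset.univ.filter fun j : Fin a => (i, j) ∈ (Finset.univ.filter fun ee : Fin a × Fin a => (ρ' ee.1, ee.2) ∈ X ∧ (ρ' ((finRotate a).symm ee.1), ee.2) ∈ X)).card : ℕ) : ℝ) := by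
    intro i
    rw [hβη, rowdeg_shiftH]
    have h1 : L ≤ t := by rw [hL]; exact min_le_left _ _
    have : L ≤ ((Finset.univ.filter fun yy : Fin a => ((ρ' i), yy) ∈ X ∧ ((ρ' (((finRotate a).symm i))), yy) ∈ X).card) := h1.trans (hgood' i)
    exact_mod_cast this
  have hcolH : ∀ j : Fin a, (q - ηη) * a ≤
      (((Finset.univ.filter fun i : Fin a => (i, j) ∈ (Finset.univ.filter fun ee : Fin a × Fin a => (ρ' ee.1, ee.2) ∈ X ∧ (ρ' ((finRotate a).symm ee.1), ee.2) ∈ X)).card : ℕ) : ℝ) := by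
    intro j
    rw [hβη, coldeg_shiftH]
    have h1 : w ≤ ((Finset.univ.filter fun kk : Fin a => (ρ kk, j) ∈ X ∧ (ρ ((finRotate a).symm kk), j) ∈ X).card) := by rw [hw]; exact hwcol j
    have h2 : ((Finset.univ.filter fun kk : Fin a => (ρ kk, j) ∈ X ∧ (ρ ((finRotate a).symm kk), j) ∈ X).card) ≤ ((Finset.univ.filter fun kk : Fin a => (ρ' kk, j) ∈ X ∧ (ρ' ((finRotate a).symm kk), j) ∈ X).card) + C.card := by
      have := colW_perturb X ρ ρ' j
      rw [← hCdef] at this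
      exact this
    have h3 : L ≤ w - C.card := by rw [hL]; exact min_le_right _ _
    have : L ≤ ((Finset.univ.filter fun kk : Fin a => (ρ' kk, j) ∈ X ∧ (ρ' ((finRotate a).symm kk), j) ∈ X).card) := h3.trans (by omega)
    exact_mod_cast this
  have hfR : (f : ℝ) ≤ (q - ηη - Real.sqrt (Real.sqrt (3 * η₁ + η₂ + 1 / a) / q)) * a := by
    have h1 : (f : ℝ) ≤ (a : ℝ) / (8 * Q) := by rw [hf]; exact_mod_cast Nat.cast_div_le
    have h2 : (q - ηη - Real.sqrt (Real.sqrt (3 * η₁ + η₂ + 1 / a) / q)) * a =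
        L - Real.sqrt (Real.sqrt (3 * η₁ + η₂ + 1 / a) / q) * a := by rw [← hβη]; ring
    rw [h2]
    have h3 : ((a / (2 * Q) : ℕ) : ℝ) ≤ L := by exact_mod_cast hLp
    have h4 : (a : ℝ) / (2 * Q) - 1 ≤ ((a / (2 * Q) : ℕ) : ℝ) := by
      have h5 : (a : ℝ) < ((a / (2 * Q) : ℕ) : ℝ) * (2 * Q) + 2 * Q := by
        exact_mod_cast Nat.lt_div_mul_add (a := a) (b := 2 * Q) (by omega)
      rw [div_sub_one (by positivity), div_le_iff₀ (by positivity)]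
      nlinarith
    have h5 : Real.sqrt (Real.sqrt (3 * η₁ + η₂ + 1 / a) / q) * a ≤ 1 / (4 * Q) * a := by gcongr
    have h6 : (1 : ℝ) ≤ (a : ℝ) / (8 * Q) := by
      rw [le_div_iff₀ (by positivity), one_mul]
      exact_mod_cast (show 8 * Q ≤ a by omega)
    have e6 : (1 : ℝ) / (4 * Q) * a = 2 * ((a : ℝ) / (8 * Q)) := by field_simp; ring
    have e7 : (a : ℝ) / (2 * Q) = 4 * ((a : ℝ) / (8 * Q)) := by field_simp; ring
    rw [e6] at h5
    rw [e7] at h4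
    linarith
  obtain ⟨Y', hY'sub, hY'row, hY'col⟩ :=
    RegularPairFactor.exists_regularFactor_of_mixing
      a f ((Finset.univ.filter fun ee : Fin a × Fin a => (ρ' ee.1, ee.2) ∈ X ∧ (ρ' ((finRotate a).symm ee.1), ee.2) ∈ X)) q (Real.sqrt (3 * η₁ + η₂ + 1 / a)) ηη hq0 hε0 hηη0 hmix hrowH hcolH hfR
  exact ⟨ρ', Y', f, hf1, hfC, hY'sub, hY'row, hY'col⟩

end Summit.ValiantsHypothesis.ValiantsHypothesis.Theorems.DivisionGap.PerMultiplesHard.OrderedFactor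

end
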